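import Summits.ValiantsHypothesis.ValiantsHypothesis.Theorems.SymPencilPerFourOneRowKernelPlane
import Summits.ValiantsHypothesis.ValiantsHypothesis.Theorems.SymPencilPerFourPermIsotropicPlanes

/-!
# Route `SymPencil` — leaf R1N of the `(11, 5, 4)` cascade, §6.5 PRODUCT kernel plane: tools (`--supports`
# stmt-ValiantsHypothesis-5674 `SdcSuperquadratic`; memo `SING-FIVE-CLASSIFICATION.md` §6.5; rung currency only)

Normalised position: zero row `0`, rank-`3` row `1` (`u`), rows `2, 3` (`v`, `w`); kernel plane
`K₁ = K(0;0;a;0) ⊕ K(0;0;0;ā)`, `a = (α, β, 0, 0)`, `ā = (α, −β, 0, 0)`; `U(z) = β z₀ + α z₁`, `Ū(z) = −β z₀ + α z₁`.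
* `reading_E`, `reading_F` — the `s¹`-readings of `Sing3` along the two pure generators (from `polar₂`);
  `relations_of_T3` — `T3 u a w = 0` ⟺ the three pair relations of `(U(u), u₂, u₃) ⊥ (U(w), w₂, w₃)` in `K³`;
* `finrank_ker_inf_ker_le`, `not_two_conditions`, `finrank_ker_functional`, `row_one_fills` — rank-`3` bookkeeping for row `1`;
* `exists_third_index`, `exists_other_index` — index bookkeeping;
* `partner_vanish` — generic element + ✓ `permOrthPairs`: three non-degenerate forms kill the partner triple;
  `bilinear_identity` — `f₁g₁ + f₂g₂ ≡ 0` with `f₁, f₂` independent ⇒ `(g₁, g₂) = λ (f₂, −f₁)`; `permOrth_pad`.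
Honest framing: [folklore] linear algebra for the PRODUCT branch of ONE leaf (R1N) of ONE of four open size-27 cells; leaf
R1N and the cell file remain OPEN; `27 ≤ sdc(per₄) ≤ 29` unchanged; the crux `SdcSuperquadratic` and `VP ≠ VNP` untouched;
no summit statement is proved here.  No definitions, no named facts.
-/

noncomputable section

set_option linter.dupNamespace false

namespace Summit.ValiantsHypothesis.ValiantsHypothesis.Theorems.SymPencilPerFourOneRowProduct

open Matrix Module MvPolynomial
open Literature.Computability.AlgebraicComplexity
open Summit.ValiantsHypothesis.ValiantsHypothesis.Theorems.SymPencilSingSixClassification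
open Summit.ValiantsHypothesis.ValiantsHypothesis.Theorems.SymPencilPerFourOneRowKernelPlane
open Summit.ValiantsHypothesis.ValiantsHypothesis.Theorems.SymPencilPerFourPermIsotropicPlanes

variable {K : Type*} [Field K]

/-! ## 1. The `s¹`-readings along the two pure generators of a PRODUCT kernel plane -/

/-- Reading (E): for `k₁ ∈ W` with rows `0, 1, 3` zero and row `2 = a`: `T3 (row y 1) a (row y 3) = 0` on `W`. [folklore] -/
theorem reading_E [CharZero K] {W : Submodule K (Fin 4 × Fin 4 → K)} (hS : Sing3 W)
    {k₁ : Fin 4 × Fin 4 → K} (hk₁ : k₁ ∈ W) (h1 : row k₁ 1 = 0) (h3 : row k₁ 3 = 0)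
    {y : Fin 4 × Fin 4 → K} (hy : y ∈ W) (l : Fin 4) : T3 (row y 1) (row k₁ 2) (row y 3) l = 0 := by
  have h := polar₂ hS (r := 1) (s := 2) (t := 3) (by decide) (by decide) (by decide) hy hk₁ h1 l
  rwa [h3, T3_zero₃, add_zero] at h

/-- Reading (F): for `k₂ ∈ W` with rows `0, 1, 2` zero and row `3 = ā`: `T3 (row y 1) (row y 2) ā = 0` on `W`. [folklore] -/
theorem reading_F [CharZero K] {W : Submodule K (Fin 4 × Fin 4 → K)} (hS : Sing3 W)
    {k₂ : Fin 4 × Fin 4 → K} (hk₂ : k₂ ∈ W) (h1 : row k₂ 1 = 0) (h2 : row k₂ 2 = 0)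
    {y : Fin 4 × Fin 4 → K} (hy : y ∈ W) (l : Fin 4) : T3 (row y 1) (row y 2) (row k₂ 3) l = 0 := by
  have h := polar₂ hS (r := 1) (s := 2) (t := 3) (by decide) (by decide) (by decide) hy hk₂ h1 l
  rwa [h2, T3_zero₂, zero_add] at h

/-- The three relations encoded by `T3 u a w = 0` for `a = (α, β, 0, 0)`, `(α, β) ≠ 0`:
`w₂ U(u) + u₂ U(w) = 0`, `w₃ U(u) + u₃ U(w) = 0`, `u₂ w₃ + u₃ w₂ = 0`, `U(z) = β z₀ + α z₁` — the vectors
`(U(u), u₂, u₃)`, `(U(w), w₂, w₃)` are perm-orthogonal in `K³` (memo §6.5 (E)). [folklore] -/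
theorem relations_of_T3 {α β : K} (hαβ : α ≠ 0 ∨ β ≠ 0) {u a w : Fin 4 → K}
    (ha0 : a 0 = α) (ha1 : a 1 = β) (ha2 : a 2 = 0) (ha3 : a 3 = 0) (h : ∀ l, T3 u a w l = 0) :
    w 2 * (β * u 0 + α * u 1) + u 2 * (β * w 0 + α * w 1) = 0 ∧
    w 3 * (β * u 0 + α * u 1) + u 3 * (β * w 0 + α * w 1) = 0 ∧
    u 2 * w 3 + u 3 * w 2 = 0 := by
  have e0 := h 0
  have e1 := h 1
  have e2 := h 2
  have e3 := h 3
  simp only [T3] at e0 e1 e2 e3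
  simp [Fin.succAbove, ha0, ha1, ha2, ha3] at e0 e1 e2 e3
  refine ⟨by linear_combination e3, by linear_combination e2, ?_⟩
  rcases hαβ with hα | hβ
  · have : α * (u 2 * w 3 + u 3 * w 2) = 0 := by linear_combination e1
    exact (mul_eq_zero.1 this).resolve_left hα
  · have : β * (u 2 * w 3 + u 3 * w 2) = 0 := by linear_combination e0
    exact (mul_eq_zero.1 this).resolve_left hβ


/-! ## 2. Dimension bookkeeping on the row space `A_r` -/

/-- Two independent linear conditions cut `K⁴` down to dimension `≤ 2`: if `f z₁ ≠ 0` and `f z₀ = 0 ≠ g z₀`, then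
`dim (ker f ⊓ ker g) ≤ 2`. [folklore] -/
theorem finrank_ker_inf_ker_le (f g : (Fin 4 → K) →ₗ[K] K) {z₁ z₀ : Fin 4 → K} (hz₁ : f z₁ ≠ 0)
    (hf0 : f z₀ = 0) (hg0 : g z₀ ≠ 0) : finrank K ↥(LinearMap.ker f ⊓ LinearMap.ker g) ≤ 2 := by
  have hker : finrank K (LinearMap.ker f) = 3 := by
    have h := LinearMap.finrank_range_add_finrank_ker f
    have hr : LinearMap.range f = ⊤ := by
      rw [LinearMap.range_eq_top]
      intro c
      refine ⟨(c / f z₁) • z₁, ?_⟩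
      rw [map_smul, smul_eq_mul, div_mul_cancel₀ c hz₁]
    rw [hr, finrank_top, Module.finrank_self, Module.finrank_fintype_fun_eq_card, Fintype.card_fin] at h
    omega
  have hlt : LinearMap.ker f ⊓ LinearMap.ker g < LinearMap.ker f := by
    refine lt_of_le_of_ne inf_le_left fun h => ?_
    have : z₀ ∈ LinearMap.ker f ⊓ LinearMap.ker g := by rw [h]; exact hf0
    exact hg0 (Submodule.mem_inf.1 this).2
  have := Submodule.finrank_lt_finrank_of_lt hlt
  omega

/-- If row `1` of `W` has rank `3`, it is not killed by two independent linear conditions. [folklore] -/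
theorem not_two_conditions {W : Submodule K (Fin 4 × Fin 4 → K)} (hnr : finrank K (W.map (rowL 1)) = 3)
    (f g : (Fin 4 → K) →ₗ[K] K) {z₁ z₀ : Fin 4 → K} (hz₁ : f z₁ ≠ 0) (hf0 : f z₀ = 0) (hg0 : g z₀ ≠ 0)
    (hf : ∀ y ∈ W, f (row y 1) = 0) (hg : ∀ y ∈ W, g (row y 1) = 0) : False := by
  have hle : W.map (rowL 1) ≤ LinearMap.ker f ⊓ LinearMap.ker g := by
    rintro _ ⟨y, hy, rfl⟩
    exact Submodule.mem_inf.2 ⟨hf y hy, hg y hy⟩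
  have h1 := Submodule.finrank_mono hle
  have h2 := finrank_ker_inf_ker_le f g hz₁ hf0 hg0
  omega


/-! ## 3. Index bookkeeping -/

/-- Index bookkeeping. [folklore] -/
theorem exists_third_index : ∀ j j' c' : Fin 4, j' ≠ c' → ∃ i : Fin 4, i ≠ j' ∧ i ≠ c' ∧ i ≠ j := by decide

/-- Index bookkeeping. [folklore] -/
theorem exists_other_index : ∀ j p : Fin 4, ∃ κ : Fin 4, κ ≠ j ∧ κ ≠ p := by decide


/-! ## 5. Generic-element tools for the `K³` perm-orthogonality relations -/

/-- **Three non-degenerate forms kill the partner** (memo §6.5 (b1)/(b3), generic element + ✓ `permOrthPairs`): if the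
linear functionals `f₀, f₁, f₂` are each not identically zero on `W` and for every `y ∈ W` the padded vectors
`(f₀ y, f₁ y, f₂ y, 0)`, `(g₀ y, g₁ y, g₂ y, 0)` are perm-orthogonal, then `g₀, g₁, g₂` vanish on `W`. [folklore] -/
theorem partner_vanish [CharZero K] {M : Type*} [AddCommGroup M] [Module K M] (W : Submodule K M)
    (f₀ f₁ f₂ g₀ g₁ g₂ : M →ₗ[K] K) (hf₀ : ∃ y ∈ W, f₀ y ≠ 0) (hf₁ : ∃ y ∈ W, f₁ y ≠ 0) (hf₂ : ∃ y ∈ W, f₂ y ≠ 0)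
    (h : ∀ y ∈ W, PermOrth ![f₀ y, f₁ y, f₂ y, 0] ![g₀ y, g₁ y, g₂ y, 0]) :
    ∀ y ∈ W, g₀ y = 0 ∧ g₁ y = 0 ∧ g₂ y = 0 := by
  classical
  have gen : ∀ (g : M →ₗ[K] K) (k : Fin 4), (∀ y, (![g₀ y, g₁ y, g₂ y, (0 : K)] : Fin 4 → K) k = g y) →
      ∀ y ∈ W, g y = 0 := by
    intro g k hk y hy
    by_contra hne
    obtain ⟨z, hz, hzT⟩ := exists_forall_ne_zero W ({0, 1, 2, 3} : Finset (Fin 4)) ![f₀, f₁, f₂, g] (by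
      intro i hi
      fin_cases i
      · simpa using hf₀
      · simpa using hf₁
      · simpa using hf₂
      · exact ⟨y, hy, by simpa using hne⟩)
    have hz0 : f₀ z ≠ 0 := by simpa using hzT 0 (by simp)
    have hz1 : f₁ z ≠ 0 := by simpa using hzT 1 (by simp)
    have hz2 : f₂ z ≠ 0 := by simpa using hzT 2 (by simp)
    have hzg : g z ≠ 0 := by simpa using hzT 3 (by simp)
    rcases permOrthPairs _ _ (h z hz) with h0 | h0 | ⟨j', c', hj'c', hsupp⟩
    · exact hz0 (by simpa using congr_fun h0 0)
    · apply hzg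
      rw [← hk z]
      simp only [h0, Pi.zero_apply]
    · obtain ⟨i, hij', hic', hi3⟩ := exists_third_index 3 j' c' hj'c'
      have := (hsupp i hij' hic').1
      fin_cases i
      · exact hz0 (by simpa using this)
      · exact hz1 (by simpa using this)
      · exact hz2 (by simpa using this)
      · exact absurd rfl hi3
  intro y hy
  exact ⟨gen g₀ 0 (fun _ => rfl) y hy, gen g₁ 1 (fun _ => rfl) y hy, gen g₂ 2 (fun _ => rfl) y hy⟩

/-- **The bilinear identity `f₁ g₁ + f₂ g₂ ≡ 0`** with `f₁, f₂` independent on `W` (witnessed by `y', y''` with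
`(f₁, f₂) = (1, 0), (0, 1)`): `g₁ = λ f₂` and `g₂ = −λ f₁` on `W` (memo §6.5 (b3), the «UFD» step). [folklore] -/
theorem bilinear_identity {M : Type*} [AddCommGroup M] [Module K M] (W : Submodule K M)
    (f₁ f₂ g₁ g₂ : M →ₗ[K] K) (h : ∀ y ∈ W, f₁ y * g₁ y + f₂ y * g₂ y = 0)
    {y' y'' : M} (hy' : y' ∈ W) (hy'' : y'' ∈ W) (h1 : f₁ y' = 1) (h2 : f₂ y' = 0) (h3 : f₁ y'' = 0)
    (h4 : f₂ y'' = 1) : ∃ lam : K, ∀ y ∈ W, g₁ y = lam * f₂ y ∧ g₂ y = -(lam * f₁ y) := by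
  have pol : ∀ a ∈ W, ∀ b ∈ W,
      f₁ a * g₁ b + f₁ b * g₁ a + f₂ a * g₂ b + f₂ b * g₂ a = 0 := by
    intro a ha b hb
    have := h (a + b) (W.add_mem ha hb)
    simp only [map_add] at this
    linear_combination this - h a ha - h b hb
  have e1 : g₁ y' = 0 := by have := h y' hy'; rw [h1, h2] at this; simpa using this
  have e2 : g₂ y'' = 0 := by have := h y'' hy''; rw [h3, h4] at this; simpa using this
  have e3 : g₂ y' = -g₁ y'' := by
    have := pol y' hy' y'' hy''
    rw [h1, h2, h3, h4, e1, e2] at this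
    linear_combination this
  refine ⟨g₁ y'', fun y hy => ⟨?_, ?_⟩⟩
  · have := pol y hy y' hy'
    rw [h1, h2, e1, e3] at this
    linear_combination this
  · have := pol y hy y'' hy''
    rw [h3, h4, e2] at this
    linear_combination this


/-- Padding two `K³` vectors by a zero fourth coordinate: perm-orthogonality from the three pair relations. [folklore] -/
theorem permOrth_pad {a₀ a₁ a₂ b₀ b₁ b₂ : K} (h01 : a₀ * b₁ + a₁ * b₀ = 0) (h02 : a₀ * b₂ + a₂ * b₀ = 0)
    (h12 : a₁ * b₂ + a₂ * b₁ = 0) : PermOrth ![a₀, a₁, a₂, 0] ![b₀, b₁, b₂, 0] := by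
  intro p q hpq
  fin_cases p <;> fin_cases q
  all_goals (first | exact absurd rfl hpq | skip)
  all_goals simp [pairPerm]
  · exact h01
  · exact h02
  · linear_combination h01
  · exact h12
  · linear_combination h02
  · linear_combination h12

/-- A non-zero linear functional on `K⁴` has a `3`-dimensional kernel. [folklore] -/
theorem finrank_ker_functional (f : (Fin 4 → K) →ₗ[K] K) {z₁ : Fin 4 → K} (hz₁ : f z₁ ≠ 0) :
    finrank K (LinearMap.ker f) = 3 := by
  have h := LinearMap.finrank_range_add_finrank_ker f
  have hr : LinearMap.range f = ⊤ := by
    rw [LinearMap.range_eq_top]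
    intro c
    refine ⟨(c / f z₁) • z₁, ?_⟩
    rw [map_smul, smul_eq_mul, div_mul_cancel₀ c hz₁]
  rw [hr, finrank_top, Module.finrank_self, Module.finrank_fintype_fun_eq_card, Fintype.card_fin] at h
  omega

/-- Row `1` of `W` fills the kernel of a functional `f` as soon as it lies inside it (rank `3`). [folklore] -/
theorem row_one_fills {W : Submodule K (Fin 4 × Fin 4 → K)} (hnr : finrank K (W.map (rowL 1)) = 3)
    (f : (Fin 4 → K) →ₗ[K] K) {z₁ : Fin 4 → K} (hz₁ : f z₁ ≠ 0) (hf : ∀ y ∈ W, f (row y 1) = 0)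
    (z : Fin 4 → K) (hz : f z = 0) : ∃ y ∈ W, row y 1 = z := by
  have hle : W.map (rowL 1) ≤ LinearMap.ker f := by
    rintro _ ⟨y, hy, rfl⟩; exact hf y hy
  have heq := Submodule.eq_of_le_of_finrank_eq hle (by rw [hnr, finrank_ker_functional f hz₁])
  have : z ∈ W.map (rowL 1) := by rw [heq]; exact hz
  obtain ⟨y, hy, hyz⟩ := Submodule.mem_map.1 this
  exact ⟨y, hy, hyz⟩

end Summit.ValiantsHypothesis.ValiantsHypothesis.Theorems.SymPencilPerFourOneRowProduct

end
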